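import Summits.QuantumFields.YangMills.Theorems.BalabanUVNodesN15TwoGridEntry2
import Summits.QuantumFields.YangMills.Theorems.BalabanUVNodesN15NeumannCubeRightEntries
import HarnessLib

/-!
# N15 (NE2) — Bałaban's full propagator pair, part N-IIp: ★★ THE FORWARD RIGHT ENTRY `𝔇(G∂_ν) = G′∂′_νP − PG∂_ν` IN (sup → L²-BLOCK) CURRENCY, HYPOTHESIS-FREE

WHO ∕ WHEN.  Cell `pub-ymgap`, seat `pub-ymgap-dag-n15-a` (g22); `--supports stmt-QuantumFields-27366 --as helper` (count-neutral).  Sequel of N-IIn∕N-IIo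
(`…NeumannCubeRightEntries(Defect)`), whose (c)⁺ was typed CONDITIONALLY on the torus letter `hSrc` of `𝔇(G′∘ρ′(sD′_ν n′), G∘ρ(sD_ν n))`; this file and its
sequel N-IIq make `hSrc` a theorem.  Service-desk input: lit-balaban ME #38 (2026-08-28): a sup∕Hölder letter with two SOURCE derivatives is NOT in print
([B5]∕[B6]∕[B9]); the L² letter (1.89)₆∕(1.114)₆ «‖ζG∇*∇*J‖» IS, and is typed (`hasMajL2_divAdj2_of_ineq`, part 62) — that is the road taken here.
WHAT.  The EXACT IDENTITY (§3 ★ `idef_gradFwd_eq`): with `∂_ν = ρ(sD_ν n) = −∇̃*_ν∘S_ν` (`sD_eq_neg_sDbar_mul_sT`), `P∘S_ν = S′_ν^{L^m}∘P` (`symbOp_sT_pow_comp_pull`) and the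
symbol identity `s − s^R = (Σ_{i<R−1} s^{i+2})(s⁻¹ − 1)` (§2 `sT_sub_sT_pow_eq`),
  `𝔇(G′∂′_ν, G∂_ν) = −𝔇(G′∇̃′*_ν, G∇̃*_ν)∘ρ(s_ν) − (n′)⁻¹·Σ_{i<L^m−1} (G′∘∇̃′*_ν∘∇̃′*_ν)∘ρ′(s_ν^{i+2})∘P`
— the backward entry `T2` of parts 69∕71 read one source step ahead, plus `L^m − 1` copies of Bałaban's sixth (1.114) entry «G∇*∇*» (TWO SOURCE DERIVATIVES, an L²
letter) at total weight `(L^m−1)∕n′ ≤ (L^k)⁻¹`.  §1 plumbing: `symbOp_sT_pow_eq_pull`, ★ `hasMaj_comp_fshift_pow` (a source shift by `t ≤ n` fine steps costs `2e^{ρ}`,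
any target currency); an (L² → ·) majorant is read as a (sup → ·) majorant up to `√(d+1)` inline (`loc_l2Blocks_le_sqrt_mul_loc_ofBlocks`).  §4 ★★ `hasMajL2_gradFwd_of_divBwd` (one torus pair: the forward
entry's (sup → L²-block) majorant from the backward one's and the fine member's (1.110)–(1.114) package).  §5 ★★★ **`hasMajL2_twoGridDefect_grad_fwd`**: for odd `L ≥ 3`,
`a > 0`, `0 < γ < 1`: `∃ δ C > 0 ∀ m_T, k ≥ 1, m, ν`, `HasMaj (ofBlocks blkFine) (l2Blocks′ η′^{d+1}) (idef P P (G′∘ρ′(sD′_ν n′)) (G∘ρ(sD_ν n))) (C·(L^k)^{−γ∕2}·e^{−δ|y−y′|_T})`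
— part 69 (`hasMajL2_twoGridDefect_div`) for the FORWARD source derivative.  The sup-output version (interpolation with part 70) is the sequel N-IIq.
HONEST FRAMING ∕ LIMITS.  Lattice algebra + block-majorant bookkeeping over LANDED rows ((1.114)₆ via `ineq110_114_pair`, part 69); no new analytic estimate; `U ≡ 1` torus
MODEL of [B5] §1; nothing of [B6] (2.38)–(2.40)∕[B9] asserted; N15 NOT discharged (object-bound; NE2⁺ NOT PRINTED); counts UNMOVED (typed 28∕28 · discharged 5∕27); one
finite torus pair per index — NOT continuum ∕ ℝ⁴ ∕ OS ∕ mass gap ∕ Clay.  Theorems only (0 `def`).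
-/

open scoped BigOperators
open Finset

namespace Summit.QuantumFields.YangMills.BalabanUVNodes.N15.TwoGrid

open Literature.MathematicalPhysics.QuantumFieldTheory.Balaban1983to89
open Literature.MathematicalPhysics.QuantumFieldTheory.Balaban1983to89.B11SectG (BlockNorm HasMaj)
open Literature.MathematicalPhysics.QuantumFieldTheory.Balaban1983to89.B11AxialTransport190 (abs_le_loc_ofBlocks loc_ofBlocks_le)
open Literature.MathematicalPhysics.QuantumFieldTheory.Balaban1983to89.T4EtaRateDefect (idef)
open Literature.MathematicalPhysics.QuantumFieldTheory.Balaban1983to89.T4EtaRateCoeffDefect (pull pull_apply)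
open Literature.MathematicalPhysics.QuantumFieldTheory.Balaban1983to89.B5Prop11Plancherel (Tor fine unitVec)
open Literature.MathematicalPhysics.QuantumFieldTheory.Balaban1983to89.B5SettingP12Real (latticeSettingP12R)
open Literature.MathematicalPhysics.QuantumFieldTheory.Balaban1983to89.B5SettingP12Weighted (etaPow etaPow_nonneg)
open Literature.MathematicalPhysics.QuantumFieldTheory.Balaban1983to89.B5SiteBridgeP12 (MP)
open Literature.MathematicalPhysics.QuantumFieldTheory.King1986.Torus (blockOf tdistT tdistT_nonneg tdistT_symm tdistT_self tdistT_triangle tdistT_sub_unitVec_le)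
open Literature.MathematicalPhysics.QuantumFieldTheory.Balaban1983to89.B6UnitTorusCarrier (unitTorusGeo)
open Summit.QuantumFields.YangMills.BalabanUVNodes.N15.VectorPiece (blkFine kingPrV blkFine_comp_kingPrV)

variable {d : ℕ}

/-! ## §1 Plumbing: power shifts on the source, L² sources read as sup sources -/

section Plumbing

variable {L : ℕ} [NeZero L] {k : ℕ} (M : Fin (d + 1) → ℕ) [∀ μ, NeZero (M μ)] (n : ℕ) [NeZero n]

omit [NeZero L] [∀ μ, NeZero (M μ)] [NeZero n] in
/-- `ρ(s_κ^t)` is the pull-back along `x ↦ x + t e_κ`. [folklore] -/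
theorem symbOp_sT_pow_eq_pull (κ : Fin (d + 1)) (t : ℕ) :
    symbOp M n (sT M n κ ^ t) = pull (fun i : Tor (fine n M) × Fin (d + 1) => (i.1 + t • unitVec (fine n M) κ, i.2)) := by
  refine LinearMap.ext fun f => funext fun i => ?_
  rw [symbOp_sT_pow_apply, pull_apply]

omit [NeZero L] in
/-- ★ **A SOURCE-SIDE SHIFT BY `t ≤ n` FINE STEPS COSTS `2e^{ρ}`** (any target currency): if `T ≤ B·e^{−ρ|y−y′|_T}` from sup-blocked fine 1-forms, then
`T∘ρ(s_κ^t) ≤ 2Be^{ρ}·e^{−ρ|y−y′|_T}` — the shifted source meets at most the block of `y′` and its `κ`-predecessor (`blockOf_add_smul_unitVec_of_le`).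
[cite: Balaban1984PropagatorsII, (2.52)–(2.55) pp.232–233 (block-majorant bookkeeping: shape); King1986, p.664 (blocks B^k(x))] -/
theorem hasMaj_comp_fshift_pow {F₂ : Type} [AddCommGroup F₂] [Module ℝ F₂] {b₂ : BlockNorm (unitTorusGeo L k M) F₂}
    {T : (Tor (fine n M) × Fin (d + 1) → ℝ) →ₗ[ℝ] F₂} {B' ρ : ℝ} (hB' : 0 ≤ B') (hρ : 0 ≤ ρ) (κ : Fin (d + 1)) {t : ℕ} (ht : t ≤ n)
    (h : HasMaj (BlockNorm.ofBlocks (unitTorusGeo L k M) (fun i : Tor (fine n M) × Fin (d + 1) => blockOf n M i.1)) b₂ T (fun y y' => B' * Real.exp (-(ρ * tdistT M y y')))) :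
    HasMaj (BlockNorm.ofBlocks (unitTorusGeo L k M) (fun i : Tor (fine n M) × Fin (d + 1) => blockOf n M i.1)) b₂ (T ∘ₗ symbOp M n (sT M n κ ^ t))
      (fun y y' => 2 * (B' * Real.exp ρ) * Real.exp (-(ρ * tdistT M y y'))) := by
  classical
  rw [symbOp_sT_pow_eq_pull]
  refine hasMaj_comp_pull_of_fibres (g := unitTorusGeo L k M) (fun i : Tor (fine n M) × Fin (d + 1) => blockOf n M i.1) _
    (fun _ _ => mul_nonneg hB' (Real.exp_nonneg _)) (fun y y' => ?_) h
  intro B hB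
  -- the fibre's blocks are `y′` and `y′ − e_κ`
  have hsub : B ⊆ ({y', y' - unitVec M κ} : Finset (Tor M)) := by
    intro z hz
    obtain ⟨x, hxz, hxs⟩ := hB z hz
    dsimp only at hxs
    obtain ⟨δ, hδ, hdich⟩ := blockOf_add_smul_unitVec_of_le M n x.1 κ ht
    rw [hxs, hxz] at hdich
    rw [Finset.mem_insert, Finset.mem_singleton]
    interval_cases δ
    · left; rw [hdich, zero_smul, add_zero]
    · right; rw [hdich, one_smul, add_sub_cancel_right]
  have hterm : ∀ z ∈ ({y', y' - unitVec M κ} : Finset (Tor M)), B' * Real.exp (-(ρ * tdistT M y z)) ≤ B' * Real.exp ρ * Real.exp (-(ρ * tdistT M y y')) := by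
    intro z hz
    rw [mul_assoc, ← Real.exp_add]
    refine mul_le_mul_of_nonneg_left (Real.exp_le_exp.mpr ?_) hB'
    have hz1 : tdistT M z y' ≤ 1 := by
      rw [Finset.mem_insert, Finset.mem_singleton] at hz
      rcases hz with rfl | rfl
      · rw [tdistT_self]; exact zero_le_one
      · rw [tdistT_symm]; exact tdistT_sub_unitVec_le M y' κ
    have htri := tdistT_triangle M y z y'
    nlinarith
  calc ∑ z ∈ B, B' * Real.exp (-(ρ * tdistT M y z))
      ≤ ∑ z ∈ ({y', y' - unitVec M κ} : Finset (Tor M)), B' * Real.exp (-(ρ * tdistT M y z)) :=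
        Finset.sum_le_sum_of_subset_of_nonneg hsub fun z _ _ => mul_nonneg hB' (Real.exp_nonneg _)
    _ ≤ ∑ _z ∈ ({y', y' - unitVec M κ} : Finset (Tor M)), B' * Real.exp ρ * Real.exp (-(ρ * tdistT M y y')) := Finset.sum_le_sum hterm
    _ = (({y', y' - unitVec M κ} : Finset (Tor M)).card : ℝ) * (B' * Real.exp ρ * Real.exp (-(ρ * tdistT M y y'))) := by rw [Finset.sum_const, nsmul_eq_mul]
    _ ≤ 2 * (B' * Real.exp ρ * Real.exp (-(ρ * tdistT M y y'))) := by
        refine mul_le_mul_of_nonneg_right ?_ (by positivity)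
        have hc : (({y', y' - unitVec M κ} : Finset (Tor M)).card) ≤ 2 := (Finset.card_insert_le _ _).trans (by rw [Finset.card_singleton])
        exact_mod_cast hc
    _ = 2 * (B' * Real.exp ρ) * Real.exp (-(ρ * tdistT M y y')) := by ring

end Plumbing


/-! ## §2 The symbol identity `s − s^R = (Σ_{i<R−1} s^{i+2})(s⁻¹ − 1)` -/

section Symbols

variable (M : Fin (d + 1) → ℕ) [∀ μ, NeZero (M μ)] (n : ℕ) [NeZero n]

omit [∀ μ, NeZero (M μ)] [NeZero n] in
/-- `s_κ − s_κ^R = (Σ_{i<R−1} s_κ^{i+2})·(s_κ⁻¹ − 1)` for `R ≥ 1` (telescoping with `s_κ s_κ⁻¹ = 1`). [folklore] -/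
theorem sT_sub_sT_pow_eq (κ : Fin (d + 1)) {R : ℕ} (hR : 1 ≤ R) :
    sT M n κ ^ 1 - sT M n κ ^ R = (∑ i ∈ range (R - 1), sT M n κ ^ (i + 2)) * (sTinv M n κ - 1) := by
  obtain ⟨R', rfl⟩ : ∃ R', R = R' + 1 := ⟨R - 1, by omega⟩
  clear hR
  rw [Nat.add_sub_cancel]
  induction R' with
  | zero => simp
  | succ R' ih =>
    have h := sT_mul_sTinv M n κ
    rw [Finset.sum_range_succ, add_mul, ← ih]
    have e : sT M n κ ^ (R' + 2) * (sTinv M n κ - 1) = sT M n κ ^ (R' + 1) * (sT M n κ * sTinv M n κ) - sT M n κ ^ (R' + 2) := by ring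
    rw [e, h]
    ring

end Symbols

/-! ## §3 ★ The exact identity behind the forward entry -/

section Identity

variable {L : ℕ} [NeZero L] (M : Fin (d + 1) → ℕ) [∀ μ, NeZero (M μ)] (k m : ℕ) (a : ℝ)

/-- ★ **`𝔇(G′∂′_ν, G∂_ν) = −𝔇(G′∇̃′*_ν, G∇̃*_ν)∘ρ(s_ν) − (n′)⁻¹·Σ_{i<L^m−1} (G′∘∇̃′*_ν∘∇̃′*_ν)∘ρ′(s_ν^{i+2})∘P`** — the forward right entry is the backward one read one
source step ahead plus `L^m − 1` two-source-derivative terms (`∂ = −∇̃*∘S`, `P∘S = S′^{L^m}∘P`, §2). [cite: Balaban1984PropagatorsI, (1.3) p.18 (lattice derivatives);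
King1986, p.664 (pairing convention)] -/
theorem idef_gradFwd_eq (ν : Fin (d + 1)) :
    idef (pull (kingPrV L k m M)) (pull (kingPrV L k m M))
        (gOp M (L ^ m * L ^ k) a ∘ₗ symbOp M (L ^ m * L ^ k) (sD M (L ^ m * L ^ k) ν ((L ^ m * L ^ k : ℕ) : ℝ)))
        (gOp M (L ^ k) a ∘ₗ symbOp M (L ^ k) (sD M (L ^ k) ν ((L ^ k : ℕ) : ℝ)))
      = -(idef (pull (kingPrV L k m M)) (pull (kingPrV L k m M))
            (gOp M (L ^ m * L ^ k) a ∘ₗ symbOp M (L ^ m * L ^ k) (((L ^ m * L ^ k : ℕ) : ℝ) • (sTinv M (L ^ m * L ^ k) ν - 1)))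
            (gOp M (L ^ k) a ∘ₗ symbOp M (L ^ k) (((L ^ k : ℕ) : ℝ) • (sTinv M (L ^ k) ν - 1))) ∘ₗ symbOp M (L ^ k) (sT M (L ^ k) ν ^ 1))
        - (((L ^ m * L ^ k : ℕ) : ℝ))⁻¹ • ∑ i ∈ range (L ^ m - 1),
            (gOp M (L ^ m * L ^ k) a ∘ₗ symbOp M (L ^ m * L ^ k) (((L ^ m * L ^ k : ℕ) : ℝ) • (sTinv M (L ^ m * L ^ k) ν - 1)) ∘ₗ
              symbOp M (L ^ m * L ^ k) (((L ^ m * L ^ k : ℕ) : ℝ) • (sTinv M (L ^ m * L ^ k) ν - 1))) ∘ₗ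
              (symbOp M (L ^ m * L ^ k) (sT M (L ^ m * L ^ k) ν ^ (i + 2)) ∘ₗ pull (kingPrV L k m M)) := by
  haveI : NeZero (L ^ k) := ⟨pow_ne_zero k (NeZero.ne L)⟩
  haveI : NeZero (L ^ m * L ^ k) := ⟨Nat.mul_ne_zero (pow_ne_zero m (NeZero.ne L)) (pow_ne_zero k (NeZero.ne L))⟩
  have hR1 : 1 ≤ L ^ m := Nat.one_le_pow _ _ (Nat.pos_of_ne_zero (NeZero.ne L))
  have hc : (((L ^ m * L ^ k : ℕ) : ℝ)) ≠ 0 := by exact_mod_cast NeZero.ne (L ^ m * L ^ k)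
  -- the two derivatives as `−∇̃*∘S`
  have hsD : symbOp M (L ^ k) (sD M (L ^ k) ν ((L ^ k : ℕ) : ℝ))
      = -(symbOp M (L ^ k) (((L ^ k : ℕ) : ℝ) • (sTinv M (L ^ k) ν - 1)) ∘ₗ symbOp M (L ^ k) (sT M (L ^ k) ν ^ 1)) := by
    rw [sD_eq_neg_sDbar_mul_sT, map_neg, map_mul, Module.End.mul_eq_comp]
  have hsD' : symbOp M (L ^ m * L ^ k) (sD M (L ^ m * L ^ k) ν ((L ^ m * L ^ k : ℕ) : ℝ))
      = -(symbOp M (L ^ m * L ^ k) (((L ^ m * L ^ k : ℕ) : ℝ) • (sTinv M (L ^ m * L ^ k) ν - 1)) ∘ₗ symbOp M (L ^ m * L ^ k) (sT M (L ^ m * L ^ k) ν ^ 1)) := by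
    rw [sD_eq_neg_sDbar_mul_sT, map_neg, map_mul, Module.End.mul_eq_comp]
  -- `P∘S = S′^{L^m}∘P`, applied
  have hPS : ∀ g, pull (kingPrV L k m M) (symbOp M (L ^ k) (sT M (L ^ k) ν ^ 1) g)
      = symbOp M (L ^ m * L ^ k) (sT M (L ^ m * L ^ k) ν ^ L ^ m) (pull (kingPrV L k m M) g) := fun g => by
    have h := LinearMap.congr_fun (symbOp_sT_pow_comp_pull (L := L) M k m ν) g
    rw [LinearMap.comp_apply, LinearMap.comp_apply] at h
    rw [pow_one, h]
  -- `S′ = S′^{L^m} + c′⁻¹ · Σ_i ∇̃′*∘S′^{i+2}` on the fine torus, applied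
  have hsym : ∀ g, symbOp M (L ^ m * L ^ k) (sT M (L ^ m * L ^ k) ν ^ 1) g
      = symbOp M (L ^ m * L ^ k) (sT M (L ^ m * L ^ k) ν ^ L ^ m) g
        + (((L ^ m * L ^ k : ℕ) : ℝ))⁻¹ • ∑ i ∈ range (L ^ m - 1),
            symbOp M (L ^ m * L ^ k) (((L ^ m * L ^ k : ℕ) : ℝ) • (sTinv M (L ^ m * L ^ k) ν - 1)) (symbOp M (L ^ m * L ^ k) (sT M (L ^ m * L ^ k) ν ^ (i + 2)) g) := by
    intro g
    have hop : symbOp M (L ^ m * L ^ k) (sT M (L ^ m * L ^ k) ν ^ 1) - symbOp M (L ^ m * L ^ k) (sT M (L ^ m * L ^ k) ν ^ L ^ m)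
        = (((L ^ m * L ^ k : ℕ) : ℝ))⁻¹ • ∑ i ∈ range (L ^ m - 1),
            symbOp M (L ^ m * L ^ k) (((L ^ m * L ^ k : ℕ) : ℝ) • (sTinv M (L ^ m * L ^ k) ν - 1)) ∘ₗ symbOp M (L ^ m * L ^ k) (sT M (L ^ m * L ^ k) ν ^ (i + 2)) := by
      rw [← map_sub, sT_sub_sT_pow_eq M (L ^ m * L ^ k) ν hR1, map_mul, map_sum, Finset.sum_mul, Finset.smul_sum]
      refine Finset.sum_congr rfl fun i _ => ?_
      rw [map_smul, LinearMap.smul_comp, smul_smul, inv_mul_cancel₀ hc, one_smul, ← Module.End.mul_eq_comp, ← map_mul, ← map_mul,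
        mul_comm (sT M (L ^ m * L ^ k) ν ^ (i + 2))]
    have h := LinearMap.congr_fun hop g
    rw [LinearMap.sub_apply, LinearMap.smul_apply, LinearMap.coe_sum, Finset.sum_apply] at h
    rw [← sub_eq_iff_eq_add', h]
    rfl
  -- assembly, pointwise
  refine LinearMap.ext fun f => ?_
  rw [idef, idef, hsD, hsD']
  simp only [LinearMap.comp_neg, LinearMap.neg_comp, LinearMap.sub_apply, LinearMap.neg_apply, LinearMap.comp_apply, LinearMap.smul_apply,
    LinearMap.coe_sum, Finset.sum_apply]
  rw [hPS f, hsym (pull (kingPrV L k m M) f),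
    map_add (symbOp M (L ^ m * L ^ k) (((L ^ m * L ^ k : ℕ) : ℝ) • (sTinv M (L ^ m * L ^ k) ν - 1))),
    map_add (gOp M (L ^ m * L ^ k) a),
    map_smul (symbOp M (L ^ m * L ^ k) (((L ^ m * L ^ k : ℕ) : ℝ) • (sTinv M (L ^ m * L ^ k) ν - 1))),
    map_smul (gOp M (L ^ m * L ^ k) a),
    map_sum (symbOp M (L ^ m * L ^ k) (((L ^ m * L ^ k : ℕ) : ℝ) • (sTinv M (L ^ m * L ^ k) ν - 1))),
    map_sum (gOp M (L ^ m * L ^ k) a)]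
  abel

end Identity

/-! ## §4 ★★ The forward entry from the backward one, one torus pair -/

section Core

variable {L : ℕ} [NeZero L] (M : Fin (d + 1) → ℕ) [∀ μ, NeZero (M μ)] (k m : ℕ) (a : ℝ)

/-- ★★ **`𝔇(G∂_ν)` IN (sup → L²-BLOCK) CURRENCY FROM `𝔇(G∇̃*_ν)`'s**, one torus pair: if `T2_ν = 𝔇(G′∇̃′*_ν, G∇̃*_ν) ≤ C₂·e^{−ρd}` (sup coarse blocks → L² fine
blocks) and the fine member satisfies Bałaban's (1.110)–(1.114) (`C₀, δ₀`, `ρ ≤ δ₀`), then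
`𝔇(G′∂′_ν, G∂_ν) ≤ (2C₂e^{ρ} + 2√(d+1)·C₀e^{ρ}·(L^k)⁻¹)·e^{−ρd}` — §3's identity, §1's source shifts, `hasMaj_comp_pull_kingPrV`, and the sixth (1.114) entry
`hasMajL2_divAdj2_of_ineq` summed `L^m − 1` times at weight `(n′)⁻¹`. [cite: Balaban1984PropagatorsI, Prop. 1.2 (1.114) p.36 (entry ‖ζG∇*∇*J‖);
Balaban1985BackgroundPropagators, Thm 3.1 (3.42) p.397 (the entry G∇*)] -/
theorem hasMajL2_gradFwd_of_divBwd {K' : ℕ} {C₀ δ₀ : ℝ} {Cα Cε : ℝ → ℝ} {Cαε : ℝ → ℝ → ℝ} (hC₀ : 0 ≤ C₀)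
    (HP' : B5.Ineq110_114 (latticeSettingP12R (L ^ m * L ^ k) M a K') C₀ Cα Cε Cαε δ₀) {C₂ ρ : ℝ} (hC₂ : 0 ≤ C₂) (hρ : 0 ≤ ρ) (hρδ : ρ ≤ δ₀)
    (ν : Fin (d + 1))
    (hT2 : HasMaj (BlockNorm.ofBlocks (unitTorusGeo L k M) (blkFine L k M))
      (BlockNorm.l2Blocks (unitTorusGeo L k M) (fun i : Tor (fine (L ^ m * L ^ k) M) × Fin (d + 1) => blockOf (L ^ m * L ^ k) M i.1)
        (etaPow (L ^ m * L ^ k) (d + 1)) (etaPow_nonneg _ _))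
      (idef (pull (kingPrV L k m M)) (pull (kingPrV L k m M))
        (gOp M (L ^ m * L ^ k) a ∘ₗ symbOp M (L ^ m * L ^ k) (((L ^ m * L ^ k : ℕ) : ℝ) • (sTinv M (L ^ m * L ^ k) ν - 1)))
        (gOp M (L ^ k) a ∘ₗ symbOp M (L ^ k) (((L ^ k : ℕ) : ℝ) • (sTinv M (L ^ k) ν - 1))))
      (fun y y' => C₂ * Real.exp (-(ρ * tdistT M y y')))) :
    HasMaj (BlockNorm.ofBlocks (unitTorusGeo L k M) (blkFine L k M))
      (BlockNorm.l2Blocks (unitTorusGeo L k M) (fun i : Tor (fine (L ^ m * L ^ k) M) × Fin (d + 1) => blockOf (L ^ m * L ^ k) M i.1)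
        (etaPow (L ^ m * L ^ k) (d + 1)) (etaPow_nonneg _ _))
      (idef (pull (kingPrV L k m M)) (pull (kingPrV L k m M))
        (gOp M (L ^ m * L ^ k) a ∘ₗ symbOp M (L ^ m * L ^ k) (sD M (L ^ m * L ^ k) ν ((L ^ m * L ^ k : ℕ) : ℝ)))
        (gOp M (L ^ k) a ∘ₗ symbOp M (L ^ k) (sD M (L ^ k) ν ((L ^ k : ℕ) : ℝ))))
      (fun y y' => (2 * (C₂ * Real.exp ρ) + 2 * (Real.sqrt ((d : ℝ) + 1) * C₀ * Real.exp ρ) * (((L ^ k : ℕ) : ℝ))⁻¹) * Real.exp (-(ρ * tdistT M y y'))) := by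
  classical
  haveI : NeZero (L ^ k) := ⟨pow_ne_zero k (NeZero.ne L)⟩
  haveI : NeZero (L ^ m * L ^ k) := ⟨Nat.mul_ne_zero (pow_ne_zero m (NeZero.ne L)) (pow_ne_zero k (NeZero.ne L))⟩
  have hL0 : 0 < L := Nat.pos_of_ne_zero (NeZero.ne L)
  have hR1 : 1 ≤ L ^ m := Nat.one_le_pow _ _ hL0
  have hn1 : 1 ≤ L ^ k := Nat.one_le_pow _ _ hL0
  have hn'1 : 1 ≤ L ^ m * L ^ k := Nat.one_le_iff_ne_zero.mpr (NeZero.ne _)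
  have hn0 : (0 : ℝ) < ((L ^ k : ℕ) : ℝ) := by exact_mod_cast hn1
  have hn'0 : (0 : ℝ) < ((L ^ m * L ^ k : ℕ) : ℝ) := by exact_mod_cast hn'1
  have hE : ∀ y y' : Tor M, 0 ≤ Real.exp (-(ρ * tdistT M y y')) := fun _ _ => Real.exp_nonneg _
  have hweak : ∀ y y' : Tor M, C₀ * Real.exp (-(δ₀ * tdistT M y y')) ≤ C₀ * Real.exp (-(ρ * tdistT M y y')) :=
    fun y y' => mul_le_mul_of_nonneg_left (Real.exp_le_exp.mpr (by nlinarith [tdistT_nonneg M y y'])) hC₀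
  set bC := BlockNorm.ofBlocks (unitTorusGeo L k M) (blkFine L k M) with hbC
  set bF := BlockNorm.ofBlocks (unitTorusGeo L k M) (fun i : Tor (fine (L ^ m * L ^ k) M) × Fin (d + 1) => blockOf (L ^ m * L ^ k) M i.1) with hbF
  set l2F := BlockNorm.l2Blocks (unitTorusGeo L k M) (fun i : Tor (fine (L ^ m * L ^ k) M) × Fin (d + 1) => blockOf (L ^ m * L ^ k) M i.1)
    (etaPow (L ^ m * L ^ k) (d + 1)) (etaPow_nonneg _ _) with hl2F
  -- (A) the backward entry read one coarse source step ahead: `2C₂e^{ρ}`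
  have hA : HasMaj bC l2F
      (idef (pull (kingPrV L k m M)) (pull (kingPrV L k m M))
        (gOp M (L ^ m * L ^ k) a ∘ₗ symbOp M (L ^ m * L ^ k) (((L ^ m * L ^ k : ℕ) : ℝ) • (sTinv M (L ^ m * L ^ k) ν - 1)))
        (gOp M (L ^ k) a ∘ₗ symbOp M (L ^ k) (((L ^ k : ℕ) : ℝ) • (sTinv M (L ^ k) ν - 1))) ∘ₗ symbOp M (L ^ k) (sT M (L ^ k) ν ^ 1))
      (fun y y' => 2 * (C₂ * Real.exp ρ) * Real.exp (-(ρ * tdistT M y y'))) :=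
    hasMaj_comp_fshift_pow (L := L) (k := k) M (L ^ k) hC₂ hρ ν hn1 hT2
  -- (B) one two-source-derivative term: `2√(d+1)C₀e^{ρ}`
  have hω : ∀ y : Tor M, etaPow (L ^ m * L ^ k) (d + 1)
      * ((univ.filter fun i : Tor (fine (L ^ m * L ^ k) M) × Fin (d + 1) => blockOf (L ^ m * L ^ k) M i.1 = y).card : ℝ) ≤ (d : ℝ) + 1 :=
    fun y => (etaPow_mul_card_fineBond M (L ^ m * L ^ k) y).le
  have h62 := (hasMajL2_divAdj2_of_ineq (L := L) M k (L ^ m * L ^ k) a hn'1 HP' hC₀ ν ν).mono fun y y' => hweak y y'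
  -- the L² source read as a sup source (`L² ≤ √(d+1)·sup` on a unit block of fine bonds)
  have h6 : HasMaj bF l2F
      (gOp M (L ^ m * L ^ k) a ∘ₗ symbOp M (L ^ m * L ^ k) (((L ^ m * L ^ k : ℕ) : ℝ) • (sTinv M (L ^ m * L ^ k) ν - 1)) ∘ₗ
        symbOp M (L ^ m * L ^ k) (((L ^ m * L ^ k : ℕ) : ℝ) • (sTinv M (L ^ m * L ^ k) ν - 1)))
      (fun y y' => Real.sqrt ((d : ℝ) + 1) * C₀ * Real.exp (-(ρ * tdistT M y y'))) := by
    intro y' μ hμ y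
    have hμ' : l2F.IsLoc y' μ := hμ
    refine (h62 y' μ hμ' y).trans ?_
    have hcmp := (loc_l2Blocks_le_sqrt_mul_loc_ofBlocks (g := unitTorusGeo L k M)
      (blk := fun i : Tor (fine (L ^ m * L ^ k) M) × Fin (d + 1) => blockOf (L ^ m * L ^ k) M i.1) (etaPow_nonneg (L ^ m * L ^ k) (d + 1)) y' μ).trans
      (mul_le_mul_of_nonneg_right (Real.sqrt_le_sqrt (hω y')) (bF.loc_nonneg y' μ))
    have hK0 : 0 ≤ C₀ * Real.exp (-(ρ * tdistT M y y')) := mul_nonneg hC₀ (hE y y')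
    calc C₀ * Real.exp (-(ρ * tdistT M y y')) * l2F.loc y' μ ≤ C₀ * Real.exp (-(ρ * tdistT M y y')) * (Real.sqrt ((d : ℝ) + 1) * bF.loc y' μ) :=
          mul_le_mul_of_nonneg_left hcmp hK0
      _ = Real.sqrt ((d : ℝ) + 1) * C₀ * Real.exp (-(ρ * tdistT M y y')) * bF.loc y' μ := by ring
  have hB : ∀ i ∈ range (L ^ m - 1), HasMaj bC l2F
      ((gOp M (L ^ m * L ^ k) a ∘ₗ symbOp M (L ^ m * L ^ k) (((L ^ m * L ^ k : ℕ) : ℝ) • (sTinv M (L ^ m * L ^ k) ν - 1)) ∘ₗ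
          symbOp M (L ^ m * L ^ k) (((L ^ m * L ^ k : ℕ) : ℝ) • (sTinv M (L ^ m * L ^ k) ν - 1))) ∘ₗ
        (symbOp M (L ^ m * L ^ k) (sT M (L ^ m * L ^ k) ν ^ (i + 2)) ∘ₗ pull (kingPrV L k m M)))
      (fun y y' => 2 * (Real.sqrt ((d : ℝ) + 1) * C₀ * Real.exp ρ) * Real.exp (-(ρ * tdistT M y y'))) := by
    intro i hi
    have hi2 : i + 2 ≤ L ^ m * L ^ k := by
      have := Finset.mem_range.mp hi
      calc i + 2 ≤ L ^ m := by omega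
        _ ≤ L ^ m * L ^ k := Nat.le_mul_of_pos_right _ (by omega)
    have hsh := hasMaj_comp_fshift_pow (L := L) (k := k) M (L ^ m * L ^ k) (mul_nonneg (Real.sqrt_nonneg _) hC₀) hρ ν hi2 h6
    have hK0 : ∀ y y' : Tor M, 0 ≤ 2 * (Real.sqrt ((d : ℝ) + 1) * C₀ * Real.exp ρ) * Real.exp (-(ρ * tdistT M y y')) := fun y y' => by positivity
    rw [← LinearMap.comp_assoc]
    exact hasMaj_comp_pull_kingPrV M k m hK0 hsh
  have hBsum := hasMaj_finsum (g := unitTorusGeo L k M) (range (L ^ m - 1)) _ _ hB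
  -- (B') the weighted sum: `(L^m − 1)∕n′ ≤ (L^k)⁻¹`
  have hBs : HasMaj bC l2F
      ((((L ^ m * L ^ k : ℕ) : ℝ))⁻¹ • ∑ i ∈ range (L ^ m - 1),
        (gOp M (L ^ m * L ^ k) a ∘ₗ symbOp M (L ^ m * L ^ k) (((L ^ m * L ^ k : ℕ) : ℝ) • (sTinv M (L ^ m * L ^ k) ν - 1)) ∘ₗ
            symbOp M (L ^ m * L ^ k) (((L ^ m * L ^ k : ℕ) : ℝ) • (sTinv M (L ^ m * L ^ k) ν - 1))) ∘ₗ
          (symbOp M (L ^ m * L ^ k) (sT M (L ^ m * L ^ k) ν ^ (i + 2)) ∘ₗ pull (kingPrV L k m M)))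
      (fun y y' => 2 * (Real.sqrt ((d : ℝ) + 1) * C₀ * Real.exp ρ) * (((L ^ k : ℕ) : ℝ))⁻¹ * Real.exp (-(ρ * tdistT M y y'))) := by
    have hs := hasMaj_smul_l2Blocks (g := unitTorusGeo L k M) (b₁ := bC) (etaPow_nonneg (L ^ m * L ^ k) (d + 1)) (((L ^ m * L ^ k : ℕ) : ℝ))⁻¹ hBsum
    refine hs.mono fun y y' => ?_
    rw [Finset.sum_const, Finset.card_range, nsmul_eq_mul, abs_inv, abs_of_nonneg hn'0.le]
    have hq : (((L ^ m * L ^ k : ℕ) : ℝ))⁻¹ * ((L ^ m - 1 : ℕ) : ℝ) ≤ (((L ^ k : ℕ) : ℝ))⁻¹ := by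
      rw [inv_mul_le_iff₀ hn'0, ← div_eq_mul_inv, le_div_iff₀ hn0]
      have h1 : ((L ^ m - 1 : ℕ) : ℝ) ≤ ((L ^ m : ℕ) : ℝ) := by exact_mod_cast Nat.sub_le _ _
      have h2 : (((L ^ m * L ^ k : ℕ) : ℝ)) = ((L ^ m : ℕ) : ℝ) * ((L ^ k : ℕ) : ℝ) := by push_cast; ring
      rw [h2]
      exact mul_le_mul_of_nonneg_right h1 hn0.le
    have h0 : 0 ≤ 2 * (Real.sqrt ((d : ℝ) + 1) * C₀ * Real.exp ρ) * Real.exp (-(ρ * tdistT M y y')) := by positivity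
    calc (((L ^ m * L ^ k : ℕ) : ℝ))⁻¹ * (((L ^ m - 1 : ℕ) : ℝ) * (2 * (Real.sqrt ((d : ℝ) + 1) * C₀ * Real.exp ρ) * Real.exp (-(ρ * tdistT M y y'))))
        = ((((L ^ m * L ^ k : ℕ) : ℝ))⁻¹ * ((L ^ m - 1 : ℕ) : ℝ)) * (2 * (Real.sqrt ((d : ℝ) + 1) * C₀ * Real.exp ρ) * Real.exp (-(ρ * tdistT M y y'))) := by ring
      _ ≤ (((L ^ k : ℕ) : ℝ))⁻¹ * (2 * (Real.sqrt ((d : ℝ) + 1) * C₀ * Real.exp ρ) * Real.exp (-(ρ * tdistT M y y'))) := mul_le_mul_of_nonneg_right hq h0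
      _ = _ := by ring
  -- assembly by §3
  rw [idef_gradFwd_eq]
  exact (hA.neg.sub hBs).mono fun y y' => le_of_eq (by ring)

end Core

/-! ## §5 ★★★ The forward entry on the torus family of record -/

section Family

variable {L : ℕ} [NeZero L]

/-- ★★★ **THE FORWARD RIGHT ENTRY OF [B9] (3.42) FOR BAŁABAN's FULL LANDAU-GAUGE PAIR `(G′, G) = (Δ′_a⁻¹, Δ_a⁻¹)` AT `U ≡ 1`, (sup → L²-BLOCK) CURRENCY, HYPOTHESIS-FREE**:
for odd `L ≥ 3`, `a > 0`, `0 < γ < 1` there are `δ, C > 0` such that for EVERY torus exponent `m_T`, EVERY coarse scale `k ≥ 1`, EVERY refinement exponent `m` and every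
direction `ν`, `𝔇(G∂_ν) = G′∘ρ′(sD′_ν n′)∘P − P∘G∘ρ(sD_ν n)` has the majorant `C·(L^k)^{−γ∕2}·e^{−δ|y−y′|_T}` from coarse 1-forms in King's unit blocks (sup) to fine
1-forms in `L²(unit block, η′^{d+1})` — part 69 (`hasMajL2_twoGridDefect_div`) for the FORWARD source derivative, by §4.
[cite: Balaban1985BackgroundPropagators, Thm 3.1 (3.42) p.397 (the entry G∇*); Balaban1984PropagatorsI, Prop. 1.2 (1.114) p.36, remark p.36 («the choice of derivatives … is accidental»)] -/
theorem hasMajL2_twoGridDefect_grad_fwd (hLodd : Odd L) (hL2 : 2 ≤ L) {a : ℝ} (ha : 0 < a) {γ : ℝ} (hγ0 : 0 < γ) (hγ1 : γ < 1) :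
    ∃ δ C : ℝ, 0 < δ ∧ 0 < C ∧ ∀ (mT k m : ℕ) (hk : 1 ≤ k) (hL : Odd L ∧ 1 < L) (ν : Fin (d + 1)),
      HasMaj (BlockNorm.ofBlocks (unitTorusGeo L k (MP (paramsOf d L mT k hL))) (blkFine L k (MP (paramsOf d L mT k hL))))
        (BlockNorm.l2Blocks (unitTorusGeo L k (MP (paramsOf d L mT k hL)))
          (fun i : Tor (fine (L ^ m * L ^ k) (MP (paramsOf d L mT k hL))) × Fin (d + 1) => blockOf (L ^ m * L ^ k) (MP (paramsOf d L mT k hL)) i.1)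
          (etaPow (L ^ m * L ^ k) (d + 1)) (etaPow_nonneg _ _))
        (idef (pull (kingPrV L k m (MP (paramsOf d L mT k hL)))) (pull (kingPrV L k m (MP (paramsOf d L mT k hL))))
          (gOp (MP (paramsOf d L mT k hL)) (L ^ m * L ^ k) a ∘ₗ
            symbOp (MP (paramsOf d L mT k hL)) (L ^ m * L ^ k) (sD (MP (paramsOf d L mT k hL)) (L ^ m * L ^ k) ν ((L ^ m * L ^ k : ℕ) : ℝ)))
          (gOp (MP (paramsOf d L mT k hL)) (L ^ k) a ∘ₗ symbOp (MP (paramsOf d L mT k hL)) (L ^ k) (sD (MP (paramsOf d L mT k hL)) (L ^ k) ν ((L ^ k : ℕ) : ℝ))))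
        (fun y y' => C * ((L ^ k : ℕ) : ℝ) ^ (-(γ / 2)) * Real.exp (-(δ * tdistT (MP (paramsOf d L mT k hL)) y y'))) := by
  classical
  have hL : Odd L ∧ 1 < L := ⟨hLodd, by omega⟩
  have hL0 : 0 < L := by omega
  have hLr1 : (1 : ℝ) ≤ (L : ℝ) := by exact_mod_cast (show 1 ≤ L by omega)
  obtain ⟨δ₂, C₂, hδ₂, hC₂, H2⟩ := hasMajL2_twoGridDefect_div (d := d) hLodd hL2 ha hγ0 hγ1
  obtain ⟨δ₅, C₀, Cα, Cε, Cαε, hδ₅, hC₀, H5⟩ := ineq110_114_pair (d := d) hL ha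
  obtain ⟨δ, hδ⟩ : ∃ δ : ℝ, δ = min δ₂ δ₅ := ⟨_, rfl⟩
  have hδpos : 0 < δ := by rw [hδ]; exact lt_min hδ₂ hδ₅
  have hδ2 : δ ≤ δ₂ := by rw [hδ]; exact min_le_left _ _
  have hδ5 : δ ≤ δ₅ := by rw [hδ]; exact min_le_right _ _
  obtain ⟨Cbig, hCbig⟩ : ∃ Cbig : ℝ, Cbig = 2 * (C₂ * Real.exp δ) + 2 * (Real.sqrt ((d : ℝ) + 1) * C₀ * Real.exp δ) := ⟨_, rfl⟩
  have hCbig0 : 0 < Cbig := by rw [hCbig]; positivity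
  refine ⟨δ, Cbig, hδpos, hCbig0, fun mT k m hk hL' ν => ?_⟩
  haveI : NeZero (L ^ k) := ⟨pow_ne_zero k (by omega)⟩
  have hn1 : 1 ≤ L ^ k := Nat.one_le_pow _ _ hL0
  have hn0 : (0 : ℝ) < ((L ^ k : ℕ) : ℝ) := by exact_mod_cast hn1
  have hnr1 : (1 : ℝ) ≤ ((L ^ k : ℕ) : ℝ) := by exact_mod_cast hn1
  obtain ⟨r, hr⟩ : ∃ r : ℝ, r = ((L ^ k : ℕ) : ℝ) ^ (-(γ / 2)) := ⟨_, rfl⟩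
  have hr0 : 0 ≤ r := by rw [hr]; exact Real.rpow_nonneg hn0.le _
  -- `(L^k)⁻¹ ≤ (L^k)^{−γ∕2}` and `(L^k)^{−γ∕2} ≤ 1`
  have hinv_le : (((L ^ k : ℕ) : ℝ))⁻¹ ≤ r := by
    rw [hr, ← Real.rpow_neg_one]
    exact Real.rpow_le_rpow_of_exponent_le hnr1 (by linarith)
  have hr1 : r ≤ 1 := by rw [hr]; exact Real.rpow_le_one_of_one_le_of_nonpos hnr1 (by linarith)
  have hE : ∀ y y' : Tor (MP (paramsOf d L mT k hL')), 0 ≤ Real.exp (-(δ * tdistT (MP (paramsOf d L mT k hL')) y y')) := fun _ _ => Real.exp_nonneg _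
  -- part 69 at the common rate `δ`, then §4
  have h2 : HasMaj (BlockNorm.ofBlocks (unitTorusGeo L k (MP (paramsOf d L mT k hL'))) (blkFine L k (MP (paramsOf d L mT k hL'))))
      (BlockNorm.l2Blocks (unitTorusGeo L k (MP (paramsOf d L mT k hL')))
        (fun i : Tor (fine (L ^ m * L ^ k) (MP (paramsOf d L mT k hL'))) × Fin (d + 1) => blockOf (L ^ m * L ^ k) (MP (paramsOf d L mT k hL')) i.1)
        (etaPow (L ^ m * L ^ k) (d + 1)) (etaPow_nonneg _ _))
      (idef (pull (kingPrV L k m (MP (paramsOf d L mT k hL')))) (pull (kingPrV L k m (MP (paramsOf d L mT k hL'))))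
        (gOp (MP (paramsOf d L mT k hL')) (L ^ m * L ^ k) a ∘ₗ
          symbOp (MP (paramsOf d L mT k hL')) (L ^ m * L ^ k) (((L ^ m * L ^ k : ℕ) : ℝ) • (sTinv (MP (paramsOf d L mT k hL')) (L ^ m * L ^ k) ν - 1)))
        (gOp (MP (paramsOf d L mT k hL')) (L ^ k) a ∘ₗ symbOp (MP (paramsOf d L mT k hL')) (L ^ k) (((L ^ k : ℕ) : ℝ) • (sTinv (MP (paramsOf d L mT k hL')) (L ^ k) ν - 1))))
      (fun y y' => C₂ * r * Real.exp (-(δ * tdistT (MP (paramsOf d L mT k hL')) y y'))) := by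
    refine (H2 mT k m hk hL' ν).mono fun y y' => ?_
    rw [← hr]
    exact mul_le_mul_of_nonneg_left (Real.exp_le_exp.mpr (neg_le_neg (mul_le_mul_of_nonneg_right hδ2 (tdistT_nonneg _ y y')))) (mul_nonneg hC₂.le hr0)
  have hmain := hasMajL2_gradFwd_of_divBwd (L := L) (MP (paramsOf d L mT k hL')) k m a hC₀.le (H5 mT k m hk).2 (mul_nonneg hC₂.le hr0) hδpos.le hδ5 ν h2
  refine hmain.mono fun y y' => mul_le_mul_of_nonneg_right ?_ (hE y y')
  rw [hCbig, ← hr]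
  have h1 : 2 * (C₂ * r * Real.exp δ) = 2 * (C₂ * Real.exp δ) * r := by ring
  have h2' : 2 * (Real.sqrt ((d : ℝ) + 1) * C₀ * Real.exp δ) * (((L ^ k : ℕ) : ℝ))⁻¹ ≤ 2 * (Real.sqrt ((d : ℝ) + 1) * C₀ * Real.exp δ) * r :=
    mul_le_mul_of_nonneg_left hinv_le (by positivity)
  rw [h1, add_mul]
  linarith

end Family

end Summit.QuantumFields.YangMills.BalabanUVNodes.N15.TwoGrid
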